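import Summits.Parity.BatemanHorn.Theses.RoughParitySectors
import Literature.NumberTheory.Sieve.AletheiaZomleferFukshanskyGarcia2020Applications

/-!
# Crux `OddSectorShareNonlinear` (stmt-Parity-15628): granted the crux, prime values infinitely often
# ↔ ONE all-odd deep-rough value infinitely often — and the Landau instance

Lead c4 of the crux, route `RoughParitySectors`; companion of
`RoughParitySectorsOddSectorShareNonlinearPrimeBounds.lean` (quantitative bounds).  Everything is PROVED
(no `sorry`, no new definition, no new fact); the crux enters only as a hypothesis (per system: its
conclusion `A_f` verbatim; at route level `OddSectorShareNonlinear` by name).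

Notation (predicates VERBATIM the route's): `R_f(x,U)` the jointly rough set (thresholds
`⌈x^{deg fᵢ/U}⌉₊`), `c₁` its prime cell, `c_odd` its all-odd sector, `A = (U e^{−γ}/2)^k`;
`A_f : ∀ η > 0 ∃ U₀ ∀ U ≥ U₀ ∀ᶠ x, |c₁·A − c_odd| ≤ η·c_odd`;
`H_f : ∀ U₀ ∃ U ≥ U₀ ∃ᶠ x, 0 < c_odd(x,U)` ("one jointly rough value with every `Ω(fᵢ(n))` odd,
for infinitely many `x`, at arbitrarily large depth").

* `ParityFlip.frequently_allPrime_of_share` — `A_f ∧ H_f ⟹ ∃ᶠ n, ∀ i, fᵢ(n) prime` (`k ≥ 1`;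
  the crux at `η = 1/2` gives `c₁A ≥ c_odd/2 > 0`, and a member of the prime cell at `(x,U)` has
  `fᵢ(n)` prime `≥ ⌈x^{deg fᵢ/U}⌉₊ → ∞`).
* `ParityFlip.oddRoughValues_of_frequently_allPrime` — conversely `∃ᶠ n, ∀ i, fᵢ(n) prime ⟹ H_f`
  for every Bateman–Horn system (no crux: `n = x` is an all-odd rough value at depth
  `U = max U₀ (2·max deg + 2)`, since a prime `fᵢ(x) ≥ x/2 > √x ≥ x^{deg fᵢ/U}`).
* `ParityFlip.frequently_allPrime_iff_oddRoughValues_of_share` — hence under `A_f`: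
  (prime values i.o.) ↔ `H_f`.
* `oddSectorShareNonlinear_frequently_allPrime_iff` — the crux BY NAME gives this for every
  Bateman–Horn system with a member of degree `≥ 2`.
* `oddSectorShareNonlinear_landauConjecture_iff` — the instance `f = (X² + 1)`: granted the crux,
  `Literature.NumberTheory.Sieve.LandauConjecture` (infinitely many primes `n² + 1`; Landau 1912, open)
  is EQUIVALENT to "for every `U₀` some `U ≥ U₀` has, for infinitely many `x`, an `n ≤ x` with `n² + 1`
  free of primes `< ⌈x^{2/U}⌉₊ and `Ω(n² + 1)` odd" — one Liouville sign `λ(n²+1) = −1` on the deep rough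
  values, infinitely often.  (Iwaniec 1978: `n² + 1 = P₂` infinitely often, parity-blind; Teräväinen
  2024 / Borwein–Choi–Ganguli 2013: sign changes of `λ(n² + 1)` unsifted — neither gives the sifted
  flip.)

So, in the kernel: the crux converts Landau's problem (and qualitative Schinzel for any nonlinear
system) into a single parity flip on deep rough values; with lead c3's
`oddSectorShareNonlinear_false_without_pairwise_not_associated_of_oddRoughValues` (the same `H` kills the
crux without `pairwise_not_associated`) this closes the circle of what `H` controls.

References: Bateman–Horn, Math. Comp. 16 (1962) [BatemanHorn1962]; E. Landau, ICM 1912 (fourth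
problem); H. Iwaniec, Invent. Math. 47 (1978) [IwaniecInventiones1978]; J. Teräväinen, Amer. J. Math.
(2024), arXiv:2010.07924 [Teravainen2024].
-/

namespace Summit.Parity.BatemanHorn.Cruxes.OddSectorShareNonlinear.Birth

open Filter Finset Polynomial
open scoped Topology
open Literature.NumberTheory.Sieve

namespace ParityFlip

/-! ### §1 Qualitative form: prime values infinitely often ↔ one all-odd rough value infinitely often -/

/-- **Crux ∧ `H_f` ⟹ all `fᵢ(n)` prime for infinitely many `n`.**  If a system `f` of `k ≥ 1`
polynomials satisfies the share statement `A_f`, and `H_f` holds — for every `U₀` some depth `U ≥ U₀`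
has, for infinitely many `x`, a jointly rough `n ∈ [1, x]` with every `Ω(fᵢ(n))` odd — then for
infinitely many `n` all the `fᵢ(n)` are (positive) primes.  (`η = 1/2`: `c₁A ≥ c_odd/2 > 0`; a member
of the prime cell at `(x, U)` has `fᵢ(n)` prime and `≥ ⌈x^{deg fᵢ/U}⌉₊ → ∞`, so `n → ∞`.) [folklore] -/
theorem frequently_allPrime_of_share {k : ℕ} {f : Fin k → ℤ[X]} (hf : IsBatemanHornSystem f)
    (hk : 0 < k)
    (hA : ∀ η : ℝ, 0 < η → ∃ U₀ : ℝ, ∀ U : ℝ, U₀ ≤ U → ∀ᶠ x : ℕ in Filter.atTop,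
      |(((((Finset.Icc 1 x).filter (fun n : ℕ => ∀ i, 0 < (f i).eval (n : ℤ) ∧
          ∀ p ∈ Finset.range ⌈(x : ℝ) ^ (((f i).natDegree : ℝ) / U)⌉₊, p.Prime →
            ¬ ((p : ℤ) ∣ (f i).eval (n : ℤ)))).filter (fun n : ℕ => ∀ i,
          ArithmeticFunction.cardFactors (((f i).eval (n : ℤ)).toNat) = 1)).card : ℕ) : ℝ) *
          (U * Real.exp (-Real.eulerMascheroniConstant) / 2) ^ k -
        (((((Finset.Icc 1 x).filter (fun n : ℕ => ∀ i, 0 < (f i).eval (n : ℤ) ∧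
          ∀ p ∈ Finset.range ⌈(x : ℝ) ^ (((f i).natDegree : ℝ) / U)⌉₊, p.Prime →
            ¬ ((p : ℤ) ∣ (f i).eval (n : ℤ)))).filter (fun n : ℕ => ∀ i,
          Odd (ArithmeticFunction.cardFactors (((f i).eval (n : ℤ)).toNat)))).card : ℕ) : ℝ)| ≤
        η * (((((Finset.Icc 1 x).filter (fun n : ℕ => ∀ i, 0 < (f i).eval (n : ℤ) ∧
          ∀ p ∈ Finset.range ⌈(x : ℝ) ^ (((f i).natDegree : ℝ) / U)⌉₊, p.Prime →
            ¬ ((p : ℤ) ∣ (f i).eval (n : ℤ)))).filter (fun n : ℕ => ∀ i,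
          Odd (ArithmeticFunction.cardFactors (((f i).eval (n : ℤ)).toNat)))).card : ℕ) : ℝ))
    (hH : ∀ U₀ : ℝ, ∃ U : ℝ, U₀ ≤ U ∧ ∃ᶠ x : ℕ in Filter.atTop,
      0 < (((Finset.Icc 1 x).filter (fun n : ℕ => ∀ i, 0 < (f i).eval (n : ℤ) ∧
          ∀ p ∈ Finset.range ⌈(x : ℝ) ^ (((f i).natDegree : ℝ) / U)⌉₊, p.Prime →
            ¬ ((p : ℤ) ∣ (f i).eval (n : ℤ)))).filter (fun n : ℕ => ∀ i,
          Odd (ArithmeticFunction.cardFactors (((f i).eval (n : ℤ)).toNat)))).card) :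
    ∃ᶠ n : ℕ in Filter.atTop, ∀ i, 0 < (f i).eval (n : ℤ) ∧ (((f i).eval (n : ℤ)).toNat).Prime := by
  obtain ⟨U₀, hU₀⟩ := hA (1 / 2) (by norm_num)
  obtain ⟨U, hUU₀, hfreq⟩ := hH (max U₀ 1)
  have hU₀U : U₀ ≤ U := le_trans (le_max_left _ _) hUU₀
  have hU0 : 0 < U := lt_of_lt_of_le one_pos (le_trans (le_max_right _ _) hUU₀)
  set i₀ : Fin k := ⟨0, hk⟩
  have hd0 : (0 : ℝ) < (f i₀).natDegree := by exact_mod_cast hf.natDegree_pos i₀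
  rw [Filter.frequently_atTop]
  intro N
  -- a bound for the values `fᵢ₀(n)`, `n < N`
  set B : ℕ := (range N).sup (fun n : ℕ => ((f i₀).eval (n : ℤ)).toNat) with hB
  have hlarge : ∀ᶠ x : ℕ in atTop, (B : ℝ) < (x : ℝ) ^ (((f i₀).natDegree : ℝ) / U) :=
    ((tendsto_rpow_atTop (by positivity)).comp tendsto_natCast_atTop_atTop).eventually_gt_atTop _
  obtain ⟨x, hco, hband, hBx⟩ := (hfreq.and_eventually ((hU₀ U hU₀U).and hlarge)).exists
  -- from the band at `η = 1/2` and `c_odd > 0`: the prime cell is non-empty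
  have hAk : 0 < (U * Real.exp (-Real.eulerMascheroniConstant) / 2) ^ k := by positivity
  have hc₁ : 0 < #(((Icc 1 x).filter (fun n : ℕ => ∀ i, 0 < (f i).eval (n : ℤ) ∧
      ∀ p ∈ range ⌈(x : ℝ) ^ (((f i).natDegree : ℝ) / U)⌉₊, p.Prime →
        ¬ ((p : ℤ) ∣ (f i).eval (n : ℤ)))).filter (fun n : ℕ => ∀ i,
      ArithmeticFunction.cardFactors (((f i).eval (n : ℤ)).toNat) = 1)) := by
    have hco' : (0 : ℝ) < ((((Icc 1 x).filter (fun n : ℕ => ∀ i, 0 < (f i).eval (n : ℤ) ∧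
        ∀ p ∈ range ⌈(x : ℝ) ^ (((f i).natDegree : ℝ) / U)⌉₊, p.Prime →
          ¬ ((p : ℤ) ∣ (f i).eval (n : ℤ)))).filter (fun n : ℕ => ∀ i,
        Odd (ArithmeticFunction.cardFactors (((f i).eval (n : ℤ)).toNat)))).card : ℕ) := by
      exact_mod_cast hco
    obtain ⟨-, h⟩ := abs_sub_le_iff.1 hband
    refine (Nat.cast_pos (α := ℝ)).1 (lt_of_not_ge fun hle => ?_)
    have h0 := le_antisymm hle (Nat.cast_nonneg (α := ℝ) _)
    rw [h0, zero_mul, sub_zero] at h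
    linarith
  obtain ⟨n, hn⟩ := card_pos.1 hc₁
  rw [mem_filter, mem_filter, mem_Icc] at hn
  obtain ⟨⟨-, hR⟩, hΩ⟩ := hn
  refine ⟨n, ?_, fun i => ⟨(hR i).1, ArithmeticFunction.cardFactors_eq_one_iff_prime.1 (hΩ i)⟩⟩
  -- `n ≥ N`: otherwise the prime `fᵢ₀(n) ≤ B < x^{deg/U}` would be a small prime factor of itself
  by_contra hnN
  push Not at hnN
  have hq : (((f i₀).eval (n : ℤ)).toNat).Prime :=
    ArithmeticFunction.cardFactors_eq_one_iff_prime.1 (hΩ i₀)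
  have hqB : ((f i₀).eval (n : ℤ)).toNat ≤ B :=
    Finset.le_sup (f := fun n : ℕ => ((f i₀).eval (n : ℤ)).toNat) (mem_range.2 hnN)
  have hqlt : ((f i₀).eval (n : ℤ)).toNat < ⌈(x : ℝ) ^ (((f i₀).natDegree : ℝ) / U)⌉₊ :=
    Nat.lt_ceil.2 (lt_of_le_of_lt (by exact_mod_cast hqB) hBx)
  exact (hR i₀).2 _ (mem_range.2 hqlt) hq (by rw [Int.toNat_of_nonneg (hR i₀).1.le])

/-- **Conversely, prime values infinitely often ⟹ `H_f`** (no crux needed).  If all `fᵢ(n)` are prime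
for infinitely many `n` (a Bateman–Horn system), then for every `U₀` the depth
`U = max U₀ (2·max deg fᵢ + 2)` has, for infinitely many `x`, an all-odd jointly rough value on `[1, x]`:
`n = x` itself (each `fᵢ(x)` is prime, `Ω = 1`, and `fᵢ(x) ≥ x/2 > √x ≥ x^{deg fᵢ/U}` is above its
sifting threshold for `x ≥ 16`). [folklore] -/
theorem oddRoughValues_of_frequently_allPrime {k : ℕ} {f : Fin k → ℤ[X]} (hf : IsBatemanHornSystem f)
    (hprime : ∃ᶠ n : ℕ in Filter.atTop,
      ∀ i, 0 < (f i).eval (n : ℤ) ∧ (((f i).eval (n : ℤ)).toNat).Prime) :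
    ∀ U₀ : ℝ, ∃ U : ℝ, U₀ ≤ U ∧ ∃ᶠ x : ℕ in Filter.atTop,
      0 < (((Finset.Icc 1 x).filter (fun n : ℕ => ∀ i, 0 < (f i).eval (n : ℤ) ∧
          ∀ p ∈ Finset.range ⌈(x : ℝ) ^ (((f i).natDegree : ℝ) / U)⌉₊, p.Prime →
            ¬ ((p : ℤ) ∣ (f i).eval (n : ℤ)))).filter (fun n : ℕ => ∀ i,
          Odd (ArithmeticFunction.cardFactors (((f i).eval (n : ℤ)).toNat)))).card := by
  intro U₀
  set D : ℕ := univ.sup fun i => (f i).natDegree with hD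
  refine ⟨max U₀ (2 * (D : ℝ) + 2), le_max_left _ _, ?_⟩
  set U : ℝ := max U₀ (2 * (D : ℝ) + 2) with hU
  have hUD : 2 * (D : ℝ) + 2 ≤ U := le_max_right _ _
  have hU0 : 0 < U := by linarith [Nat.cast_nonneg (α := ℝ) D]
  choose M hM using fun i =>
    Theorems.BalancedSemiprimeLayer.Negative.exists_pow_le_two_mul_eval (hf.leadingCoeff_pos i)
  refine (hprime.and_eventually (eventually_ge_atTop (max (univ.sup M) 16))).mono
    fun x ⟨hpx, hxM⟩ => ?_
  have hx16 : 16 ≤ x := le_trans (le_max_right _ _) hxM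
  refine card_pos.2 ⟨x, ?_⟩
  rw [mem_filter, mem_filter, mem_Icc]
  refine ⟨⟨⟨by omega, le_rfl⟩, fun i => ⟨(hpx i).1, fun p hp hpp hdvd => ?_⟩⟩, fun i => ?_⟩
  · have hMi : M i ≤ x := le_trans (Finset.le_sup (f := M) (mem_univ i)) (le_trans (le_max_left _ _) hxM)
    have hgrow := hM i x hMi
    have hxle : (x : ℤ) ≤ (x : ℤ) ^ (f i).natDegree := by
      exact_mod_cast Nat.le_self_pow (hf.natDegree_pos i).ne' x
    have hpn : p ∣ ((f i).eval (x : ℤ)).toNat := by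
      rw [← Int.natCast_dvd_natCast, Int.toNat_of_nonneg (hpx i).1.le]; exact hdvd
    have hpeq : p = ((f i).eval (x : ℤ)).toNat := (Nat.prime_dvd_prime_iff_eq hpp (hpx i).2).1 hpn
    have h2p : (x : ℝ) ≤ 2 * p := by
      have : (x : ℤ) ≤ 2 * (p : ℤ) := by
        rw [hpeq, Int.toNat_of_nonneg (hpx i).1.le]; linarith
      exact_mod_cast this
    rw [mem_range, Nat.lt_ceil] at hp
    have hdi : ((f i).natDegree : ℝ) ≤ D := by
      exact_mod_cast Finset.le_sup (f := fun i => (f i).natDegree) (mem_univ i)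
    have hexp : ((f i).natDegree : ℝ) / U ≤ 1 / 2 := by
      rw [div_le_iff₀ hU0]; linarith
    have hx1 : (1 : ℝ) ≤ x := by exact_mod_cast (show 1 ≤ x by omega)
    have hX : (0 : ℝ) < x := by linarith
    have hsqrt : (x : ℝ) ^ (((f i).natDegree : ℝ) / U) ≤ (x : ℝ) ^ (1 / 2 : ℝ) :=
      Real.rpow_le_rpow_of_exponent_le hx1 hexp
    set s : ℝ := (x : ℝ) ^ (1 / 2 : ℝ) with hs
    have hs0 : 0 ≤ s := by positivity
    have hss : s * s = x := by
      rw [hs, ← Real.rpow_add hX]; norm_num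
    have h16 : (16 : ℝ) ≤ x := by exact_mod_cast hx16
    have hs4 : 4 ≤ s := by nlinarith
    have hsx : 4 * s ≤ x := by nlinarith
    have hp' : (p : ℝ) < s := lt_of_lt_of_le hp hsqrt
    linarith
  · rw [ArithmeticFunction.cardFactors_apply_prime (hpx i).2]
    exact odd_one

/-- **Under the crux, "all `fᵢ(n)` prime infinitely often" ↔ `H_f`** (one all-odd jointly rough value,
infinitely often, at arbitrarily large depth), for every Bateman–Horn system of `k ≥ 1` polynomials
satisfying the share statement `A_f`. [folklore] -/
theorem frequently_allPrime_iff_oddRoughValues_of_share {k : ℕ} {f : Fin k → ℤ[X]}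
    (hf : IsBatemanHornSystem f) (hk : 0 < k)
    (hA : ∀ η : ℝ, 0 < η → ∃ U₀ : ℝ, ∀ U : ℝ, U₀ ≤ U → ∀ᶠ x : ℕ in Filter.atTop,
      |(((((Finset.Icc 1 x).filter (fun n : ℕ => ∀ i, 0 < (f i).eval (n : ℤ) ∧
          ∀ p ∈ Finset.range ⌈(x : ℝ) ^ (((f i).natDegree : ℝ) / U)⌉₊, p.Prime →
            ¬ ((p : ℤ) ∣ (f i).eval (n : ℤ)))).filter (fun n : ℕ => ∀ i,
          ArithmeticFunction.cardFactors (((f i).eval (n : ℤ)).toNat) = 1)).card : ℕ) : ℝ) *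
          (U * Real.exp (-Real.eulerMascheroniConstant) / 2) ^ k -
        (((((Finset.Icc 1 x).filter (fun n : ℕ => ∀ i, 0 < (f i).eval (n : ℤ) ∧
          ∀ p ∈ Finset.range ⌈(x : ℝ) ^ (((f i).natDegree : ℝ) / U)⌉₊, p.Prime →
            ¬ ((p : ℤ) ∣ (f i).eval (n : ℤ)))).filter (fun n : ℕ => ∀ i,
          Odd (ArithmeticFunction.cardFactors (((f i).eval (n : ℤ)).toNat)))).card : ℕ) : ℝ)| ≤
        η * (((((Finset.Icc 1 x).filter (fun n : ℕ => ∀ i, 0 < (f i).eval (n : ℤ) ∧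
          ∀ p ∈ Finset.range ⌈(x : ℝ) ^ (((f i).natDegree : ℝ) / U)⌉₊, p.Prime →
            ¬ ((p : ℤ) ∣ (f i).eval (n : ℤ)))).filter (fun n : ℕ => ∀ i,
          Odd (ArithmeticFunction.cardFactors (((f i).eval (n : ℤ)).toNat)))).card : ℕ) : ℝ)) :
    (∃ᶠ n : ℕ in Filter.atTop, ∀ i, 0 < (f i).eval (n : ℤ) ∧ (((f i).eval (n : ℤ)).toNat).Prime) ↔
      ∀ U₀ : ℝ, ∃ U : ℝ, U₀ ≤ U ∧ ∃ᶠ x : ℕ in Filter.atTop,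
        0 < (((Finset.Icc 1 x).filter (fun n : ℕ => ∀ i, 0 < (f i).eval (n : ℤ) ∧
            ∀ p ∈ Finset.range ⌈(x : ℝ) ^ (((f i).natDegree : ℝ) / U)⌉₊, p.Prime →
              ¬ ((p : ℤ) ∣ (f i).eval (n : ℤ)))).filter (fun n : ℕ => ∀ i,
            Odd (ArithmeticFunction.cardFactors (((f i).eval (n : ℤ)).toNat)))).card :=
  ⟨oddRoughValues_of_frequently_allPrime hf, frequently_allPrime_of_share hf hk hA⟩

end ParityFlip

/-! ### §2 Route level: the crux `OddSectorShareNonlinear` BY NAME, and the Landau instance -/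

open Summit.Parity.BatemanHorn.Theses.RoughParitySectors

/-- **`OddSectorShareNonlinear` ⟹ for every Bateman–Horn system with a member of degree `≥ 2`,
"all `fᵢ(n)` prime for infinitely many `n`" (qualitative Bateman–Horn / Schinzel for `f`) is
EQUIVALENT to `H_f`: one jointly rough value with all `Ω(fᵢ(n))` odd, for infinitely many `x`, at
arbitrarily large depth.**  Granted the crux, infinitude of prime values along a nonlinear system is
exactly one parity flip on its deep rough values, infinitely often. [folklore] -/
theorem oddSectorShareNonlinear_frequently_allPrime_iff (h : OddSectorShareNonlinear) :
    ∀ (k : ℕ) (f : Fin k → ℤ[X]), IsBatemanHornSystem f → (∃ i, 2 ≤ (f i).natDegree) →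
      ((∃ᶠ n : ℕ in Filter.atTop,
          ∀ i, 0 < (f i).eval (n : ℤ) ∧ (((f i).eval (n : ℤ)).toNat).Prime) ↔
        ∀ U₀ : ℝ, ∃ U : ℝ, U₀ ≤ U ∧ ∃ᶠ x : ℕ in Filter.atTop,
          0 < (((Finset.Icc 1 x).filter (fun n : ℕ => ∀ i, 0 < (f i).eval (n : ℤ) ∧
              ∀ p ∈ Finset.range ⌈(x : ℝ) ^ (((f i).natDegree : ℝ) / U)⌉₊, p.Prime →
                ¬ ((p : ℤ) ∣ (f i).eval (n : ℤ)))).filter (fun n : ℕ => ∀ i,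
              Odd (ArithmeticFunction.cardFactors (((f i).eval (n : ℤ)).toNat)))).card) :=
  fun k f hf hd => ParityFlip.frequently_allPrime_iff_oddRoughValues_of_share hf
    (by obtain ⟨i, -⟩ := hd; exact i.pos) (h k f hf hd)


/-- The system `(X² + 1)`: its all-odd jointly rough count at `(x, U)` written over `ℕ`
(`(X²+1)(n) = n² + 1 > 0`, `deg = 2`, `(p : ℤ) ∣ n² + 1 ↔ p ∣ n² + 1`). [folklore] -/
theorem oddSector_X_sq_add_one_card (x : ℕ) (U : ℝ) :
    (((Finset.Icc 1 x).filter (fun n : ℕ => ∀ i : Fin 1,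
        0 < ((![(X ^ (2 : ℕ) + 1 : ℤ[X])]) i).eval (n : ℤ) ∧
        ∀ p ∈ Finset.range ⌈(x : ℝ) ^ ((((![(X ^ (2 : ℕ) + 1 : ℤ[X])]) i).natDegree : ℝ) / U)⌉₊,
          p.Prime → ¬ ((p : ℤ) ∣ ((![(X ^ (2 : ℕ) + 1 : ℤ[X])]) i).eval (n : ℤ)))).filter
        (fun n : ℕ => ∀ i : Fin 1, Odd (ArithmeticFunction.cardFactors
          ((((![(X ^ (2 : ℕ) + 1 : ℤ[X])]) i).eval (n : ℤ)).toNat)))).card =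
    (((Finset.Icc 1 x).filter (fun n : ℕ =>
        ∀ p ∈ Finset.range ⌈(x : ℝ) ^ ((2 : ℝ) / U)⌉₊, p.Prime → ¬ (p ∣ n ^ 2 + 1))).filter
        (fun n : ℕ => Odd (ArithmeticFunction.cardFactors (n ^ 2 + 1)))).card := by
  have hdeg : (X ^ (2 : ℕ) + 1 : ℤ[X]).natDegree = 2 := by
    simpa using natDegree_X_pow_add_C (n := 2) (r := (1 : ℤ))
  have hev : ∀ n : ℕ, (X ^ (2 : ℕ) + 1 : ℤ[X]).eval (n : ℤ) = ((n ^ 2 + 1 : ℕ) : ℤ) := by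
    intro n; push_cast; simp [eval_add, eval_pow, eval_X, eval_one]
  congr 1
  ext n
  simp only [mem_filter, Fin.forall_fin_one, Matrix.cons_val_fin_one, hdeg, hev, Int.toNat_natCast,
    Int.natCast_dvd_natCast, Nat.cast_ofNat, Nat.cast_pos]
  constructor
  · rintro ⟨⟨hI, -, hR⟩, hO⟩
    exact ⟨⟨hI, hR⟩, hO⟩
  · rintro ⟨⟨hI, hR⟩, hO⟩
    exact ⟨⟨hI, Nat.succ_pos _, hR⟩, hO⟩

/-- **Granted the crux, Landau's problem is one parity flip on the deep rough values of `n² + 1`.**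
`OddSectorShareNonlinear → (LandauConjecture ↔ ∀ U₀ ∃ U ≥ U₀ ∃ᶠ x, some n ∈ [1, x] has n² + 1 free of
primes < ⌈x^{2/U}⌉₊ with Ω(n² + 1) odd)` — the instance `f = (X² + 1)`
(`isBatemanHornSystem_X_sq_add_one`) of `oddSectorShareNonlinear_frequently_allPrime_iff`;
`LandauConjecture` is the tree's `{n : ℕ | (n² + 1).Prime}.Infinite` (Landau 1912, open). [folklore] -/
theorem oddSectorShareNonlinear_landauConjecture_iff :
    Summit.Parity.BatemanHorn.Theses.RoughParitySectors.OddSectorShareNonlinear →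
    (Literature.NumberTheory.Sieve.LandauConjecture ↔
      ∀ U₀ : ℝ, ∃ U : ℝ, U₀ ≤ U ∧ ∃ᶠ x : ℕ in Filter.atTop,
        0 < (((Finset.Icc 1 x).filter (fun n : ℕ =>
            ∀ p ∈ Finset.range ⌈(x : ℝ) ^ ((2 : ℝ) / U)⌉₊, p.Prime → ¬ (p ∣ n ^ 2 + 1))).filter
            (fun n : ℕ => Odd (ArithmeticFunction.cardFactors (n ^ 2 + 1)))).card) := by
  intro h
  have hdeg : (X ^ (2 : ℕ) + 1 : ℤ[X]).natDegree = 2 := by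
    simpa using natDegree_X_pow_add_C (n := 2) (r := (1 : ℤ))
  have hev : ∀ n : ℕ, (X ^ (2 : ℕ) + 1 : ℤ[X]).eval (n : ℤ) = ((n ^ 2 + 1 : ℕ) : ℤ) := by
    intro n; push_cast; simp [eval_add, eval_pow, eval_X, eval_one]
  have key := oddSectorShareNonlinear_frequently_allPrime_iff h 1 ![(X ^ (2 : ℕ) + 1 : ℤ[X])]
    isBatemanHornSystem_X_sq_add_one ⟨0, by simp [hdeg]⟩
  have hL : (∃ᶠ n : ℕ in Filter.atTop, ∀ i : Fin 1,
      0 < ((![(X ^ (2 : ℕ) + 1 : ℤ[X])]) i).eval (n : ℤ) ∧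
        ((((![(X ^ (2 : ℕ) + 1 : ℤ[X])]) i).eval (n : ℤ)).toNat).Prime) ↔ LandauConjecture := by
    unfold LandauConjecture
    rw [← Nat.frequently_atTop_iff_infinite]
    simp only [Fin.forall_fin_one, Matrix.cons_val_fin_one, hev, Int.toNat_natCast, Nat.cast_pos]
    exact ⟨fun h' => h'.mono fun n hn => hn.2, fun h' => h'.mono fun n hn => ⟨Nat.succ_pos _, hn⟩⟩
  rw [hL] at key
  simpa only [oddSector_X_sq_add_one_card] using key

end Summit.Parity.BatemanHorn.Cruxes.OddSectorShareNonlinear.Birth
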